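import Mathlib
import HarnessLib
import Summits.NavierStokesRegularity.NavierStokesRegularity.Theorems.PoloidalWindowDoorPoloidalWindowRigidityLocalFrozenLaw
import Summits.NavierStokesRegularity.NavierStokesRegularity.Theorems.PoloidalWindowDoorLrcModEntireTwistingThickLeafwise

/-!
# Crux `PoloidalWindowRigidity` (K2, stmt-NavierStokesRegularity-19708), line `local_rigidity` v1 — the registered stub S2 `stub_localThickTH`
# VERBATIM from the jet-pinned local statements `hthick` / `hleaf` (purely local: no class input)

Cell ns-regularity-ideate, seat ns-poloidal-K2-p4 gen 0 (THICK column; lead ns-poloidal-K2-p2; `--supports stmt-NavierStokesRegularity-19708` helper).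
Pool seat ns-poloidal-K2-p5 landed the LOCAL frozen law (`…LocalFrozenLaw.vertShear_wedge_horizGrad_eq_zero`: on a poloidal classical NS germ on an open
region, `∂₂u₀·∂₁u₂ = ∂₂u₁·∂₀u₂`).  With it, this seat's conversion «THICK ⇒ a nonempty OPEN sub-window with `∇ₕΛ ≠ 0`» (class form:
`…LrcModEntireTwistingThickOfLocalOpen.exists_isOpen_slopeGrad_ne_zero`) runs for CLASS-FREE local germs — joint analyticity of the germ on the
open set is all it needs:

* `exists_isOpen_slopeGrad_ne_zero_local` — `u` jointly real-analytic on an open nonempty `U`, frozen with `∇ₕu₂ ≠ 0` on `U`, time–height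
  (`∂₂u_b = m(t,y₂)∂_bu₂`) on NO nonempty open subset of `U` ⇒ `∃ U' ⊆ U` open nonempty with `∂₀Λ ≠ 0 ∨ ∂₁Λ ≠ 0` everywhere on `U'`
  (`Λ = ⟪∂₂uₕ,∇ₕu₂⟩/|∇ₕu₂|²`);
* `stub_localThickTH_of_localThickOpen` — **S2 `stub_localThickTH` of `Cruxes/PoloidalWindowRigidity/Lines/local_rigidity.lean` (v1) VERBATIM from
  `hthick`** («no real-analytic classical NS pair on a nonempty open set is everywhere poloidal ∧ frozen ∧ non-degenerate ∧ twisting ∧ `∇ₕΛ ≠ 0`»):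
  by contraposition a germ violating S2 is thick, hence has an open sub-window with `∇ₕΛ ≠ 0`, which `hthick` forbids (frozen from K2-p5's law);
* `stub_localThickTH_of_localThickLeaf` — S2 VERBATIM from `hleaf` (pin `∂ₙΛ ≠ 0` + leafwise; via `…TwistingThickLeafwise.localThickOpen_of_localThickLeaf`).

So the registered stub S2 and the jet-pinned statements are now linked both ways in the tree (S2 ⇒ the class-level thick stubs:
`…HyperbolicThickOfLocal.stub_hyperbolicThick_of_localThickTH`, skeleton `twisting_of_localRigidity`; `hleaf ⇒ hthick ⇒ S2`: this file): ONE exact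
certificate against `hleaf` — an all-orders INCONSISTENCY of {NS momentum with pressure, div u = 0, ω₂ = 0} with the OPEN pins {twist ≠ 0, ∇ₕu₂ ≠ 0,
∂₂uₕ ≠ 0, curl u ≠ 0, ∂ₙΛ ≠ 0} at a point — closes S2 by name, hence (with `hempty`) `stub_twisting` and the crux chain.

WHAT THIS IS NOT: not a proof of S2, of the crux, or of anything about Navier–Stokes regularity (Clay (A) untouched).  bears_on LADDER-NS N0, crux
19708 (local_rigidity S2; mixed_type `stub_hyperbolicThick`), item 20428 (`stub_twistingThick`).
-/

noncomputable section

-- the summit and its single sub-problem share the name (CONVENTIONS §1), as in every Theorems file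
set_option linter.dupNamespace false

namespace Summit.NavierStokesRegularity.NavierStokesRegularity.Theorems.PoloidalWindowDoorPoloidalWindowRigidityLocalThickTHOfLocalOpen

open Set Function Metric Filter
open scoped RealInnerProductSpace InnerProductSpace Topology
open Literature.Analysis Literature.Analysis.FluidPDE
open Summit.NavierStokesRegularity.NavierStokesRegularity.Theorems
open Summit.NavierStokesRegularity.NavierStokesRegularity.Theorems.PoloidalWindowDoorPoloidalWindowRigidityHyperbolicThickOfLocalOpen
open Summit.NavierStokesRegularity.NavierStokesRegularity.Theorems.PoloidalWindowDoorLrcModEntireTwistingThickLeafwise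
open Summit.NavierStokesRegularity.NavierStokesRegularity.Theorems.PoloidalWindowDoorPoloidalWindowRigidityLocalFrozenLaw

/-! ### THICK ⇒ an open sub-window with `∇ₕΛ ≠ 0`, for class-free analytic germs -/

/-- **Local form of `exists_isOpen_slopeGrad_ne_zero`.**  For `u : ℝ → ℝ³ → ℝ³` jointly real-analytic on an open nonempty `U ⊆ ℝ × ℝ³`, frozen
(`∂₂u₀·∂₁u₂ = ∂₂u₁·∂₀u₂`) with `∇ₕu₂ ≠ 0` on `U`, and time–height on NO nonempty open subset of `U`: some nonempty open `U' ⊆ U` carries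
`∂₀Λ ≠ 0 ∨ ∂₁Λ ≠ 0` at every point. -/
theorem exists_isOpen_slopeGrad_ne_zero_local {u : ℝ → EuclideanSpace ℝ (Fin 3) → EuclideanSpace ℝ (Fin 3)}
    {U : Set (ℝ × EuclideanSpace ℝ (Fin 3))} (hU : IsOpen U) (hUne : U.Nonempty) (han : AnalyticOnNhd ℝ (uncurry u) U)
    (hfr : ∀ p ∈ U,
      fderiv ℝ (u p.1) p.2 (EuclideanSpace.single 2 1) 0 * fderiv ℝ (u p.1) p.2 (EuclideanSpace.single 1 1) 2 =
        fderiv ℝ (u p.1) p.2 (EuclideanSpace.single 2 1) 1 * fderiv ℝ (u p.1) p.2 (EuclideanSpace.single 0 1) 2)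
    (hnd : ∀ p ∈ U, fderiv ℝ (u p.1) p.2 (EuclideanSpace.single 0 1) 2 ≠ 0 ∨ fderiv ℝ (u p.1) p.2 (EuclideanSpace.single 1 1) 2 ≠ 0)
    (hthick : ∀ m : ℝ → ℝ → ℝ, ∀ U₁ : Set (ℝ × EuclideanSpace ℝ (Fin 3)), U₁ ⊆ U → IsOpen U₁ → U₁.Nonempty →
      ∃ p ∈ U₁, ∃ b : Fin 3, b ≠ 2 ∧
        fderiv ℝ (u p.1) p.2 (EuclideanSpace.single 2 1) b ≠ m p.1 (p.2 2) * fderiv ℝ (u p.1) p.2 (EuclideanSpace.single b 1) 2) :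
    ∃ U' : Set (ℝ × EuclideanSpace ℝ (Fin 3)), U' ⊆ U ∧ IsOpen U' ∧ U'.Nonempty ∧ ∀ p ∈ U',
      fderiv ℝ (fun y => (fderiv ℝ (u p.1) y (EuclideanSpace.single 2 1) 0 * fderiv ℝ (u p.1) y (EuclideanSpace.single 0 1) 2 +
              fderiv ℝ (u p.1) y (EuclideanSpace.single 2 1) 1 * fderiv ℝ (u p.1) y (EuclideanSpace.single 1 1) 2) /
            (fderiv ℝ (u p.1) y (EuclideanSpace.single 0 1) 2 ^ 2 + fderiv ℝ (u p.1) y (EuclideanSpace.single 1 1) 2 ^ 2)) p.2 (EuclideanSpace.single 0 1) ≠ 0 ∨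
      fderiv ℝ (fun y => (fderiv ℝ (u p.1) y (EuclideanSpace.single 2 1) 0 * fderiv ℝ (u p.1) y (EuclideanSpace.single 0 1) 2 +
              fderiv ℝ (u p.1) y (EuclideanSpace.single 2 1) 1 * fderiv ℝ (u p.1) y (EuclideanSpace.single 1 1) 2) /
            (fderiv ℝ (u p.1) y (EuclideanSpace.single 0 1) 2 ^ 2 + fderiv ℝ (u p.1) y (EuclideanSpace.single 1 1) 2 ^ 2)) p.2 (EuclideanSpace.single 1 1) ≠ 0 := by
  -- ## the ratio `Λ` and its joint analyticity on `U`
  set Λv : ℝ → EuclideanSpace ℝ (Fin 3) → ℝ := fun t y =>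
    (fderiv ℝ (u t) y (EuclideanSpace.single 2 1) 0 * fderiv ℝ (u t) y (EuclideanSpace.single 0 1) 2 +
        fderiv ℝ (u t) y (EuclideanSpace.single 2 1) 1 * fderiv ℝ (u t) y (EuclideanSpace.single 1 1) 2) /
      (fderiv ℝ (u t) y (EuclideanSpace.single 0 1) 2 ^ 2 + fderiv ℝ (u t) y (EuclideanSpace.single 1 1) 2 ^ 2) with hΛv
  have hent : ∀ j i : Fin 3, ∀ z ∈ U,
      AnalyticAt ℝ (uncurry fun s y => fderiv ℝ (u s) y (EuclideanSpace.single j 1) i) z := by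
    intro j i z hz
    have h := analyticAt_uncurry_fderiv_slice_apply (han z hz) (EuclideanSpace.single j 1)
    have e : (uncurry fun s y => fderiv ℝ (u s) y (EuclideanSpace.single j 1) i) =
        (EuclideanSpace.proj i : EuclideanSpace ℝ (Fin 3) →L[ℝ] ℝ) ∘
          (uncurry fun s y => fderiv ℝ (u s) y (EuclideanSpace.single j 1)) := by
      funext p; rfl
    rw [e]
    exact ((EuclideanSpace.proj i : EuclideanSpace ℝ (Fin 3) →L[ℝ] ℝ).analyticAt _).comp h
  have hΛan : ∀ z ∈ U, AnalyticAt ℝ (uncurry Λv) z := by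
    intro z hz
    have hden : (uncurry fun s y => fderiv ℝ (u s) y (EuclideanSpace.single 0 1) 2 ^ 2 +
        fderiv ℝ (u s) y (EuclideanSpace.single 1 1) 2 ^ 2) z ≠ 0 := by
      rcases hnd z hz with h | h
      · have h' : 0 < fderiv ℝ (u z.1) z.2 (EuclideanSpace.single 0 1) 2 ^ 2 := by positivity
        have := sq_nonneg (fderiv ℝ (u z.1) z.2 (EuclideanSpace.single 1 1) 2)
        exact ne_of_gt (by simp only [uncurry]; linarith)
      · have h' : 0 < fderiv ℝ (u z.1) z.2 (EuclideanSpace.single 1 1) 2 ^ 2 := by positivity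
        have := sq_nonneg (fderiv ℝ (u z.1) z.2 (EuclideanSpace.single 0 1) 2)
        exact ne_of_gt (by simp only [uncurry]; linarith)
    have hnum : AnalyticAt ℝ (uncurry fun s y =>
        fderiv ℝ (u s) y (EuclideanSpace.single 2 1) 0 * fderiv ℝ (u s) y (EuclideanSpace.single 0 1) 2 +
          fderiv ℝ (u s) y (EuclideanSpace.single 2 1) 1 * fderiv ℝ (u s) y (EuclideanSpace.single 1 1) 2) z :=
      ((hent 2 0 z hz).mul (hent 0 2 z hz)).add ((hent 2 1 z hz).mul (hent 1 2 z hz))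
    have hden' : AnalyticAt ℝ (uncurry fun s y => fderiv ℝ (u s) y (EuclideanSpace.single 0 1) 2 ^ 2 +
        fderiv ℝ (u s) y (EuclideanSpace.single 1 1) 2 ^ 2) z :=
      ((hent 0 2 z hz).pow 2).add ((hent 1 2 z hz).pow 2)
    exact hnum.div hden' hden
  have hG : ∀ b : Fin 3, ∀ z ∈ U,
      ContinuousAt (uncurry fun t y => fderiv ℝ (Λv t) y (EuclideanSpace.single b 1)) z :=
    fun b z hz => (analyticAt_uncurry_fderiv_slice_apply (hΛan z hz) (EuclideanSpace.single b 1)).continuousAt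
  by_cases hA : ∃ p₀ ∈ U, fderiv ℝ (Λv p₀.1) p₀.2 (EuclideanSpace.single 0 1) ≠ 0 ∨
      fderiv ℝ (Λv p₀.1) p₀.2 (EuclideanSpace.single 1 1) ≠ 0
  · -- ## Case A: the open sub-window `{∇ₕΛ ≠ 0}` is nonempty
    obtain ⟨p₀, hp₀, hp₀'⟩ := hA
    refine ⟨{z | z ∈ U ∧ (fderiv ℝ (Λv z.1) z.2 (EuclideanSpace.single 0 1) ≠ 0 ∨
        fderiv ℝ (Λv z.1) z.2 (EuclideanSpace.single 1 1) ≠ 0)}, fun z hz => hz.1, ?_, ⟨p₀, hp₀, hp₀'⟩, fun p hp => hp.2⟩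
    rw [isOpen_iff_mem_nhds]
    rintro z ⟨hzU, hz⟩
    have hUn : U ∈ 𝓝 z := hU.mem_nhds hzU
    rcases hz with h | h
    · have h0 := (hG 0 z hzU).eventually_ne h
      filter_upwards [hUn, h0] with z' hz'U hz'
      exact ⟨hz'U, Or.inl hz'⟩
    · have h1 := (hG 1 z hzU).eventually_ne h
      filter_upwards [hUn, h1] with z' hz'U hz'
      exact ⟨hz'U, Or.inr hz'⟩
  · -- ## Case B: `∇ₕΛ ≡ 0` on `U` — a ball of `U` is time–height, contradicting thickness
    exfalso
    push Not at hA
    obtain ⟨z₀, hz₀⟩ := hUne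
    obtain ⟨r, hr, hball⟩ := Metric.isOpen_iff.1 hU z₀ hz₀
    set m : ℝ → ℝ → ℝ := fun t z => Λv t (z₀.2 + (z - z₀.2 2) • EuclideanSpace.single 2 (1 : ℝ)) with hm
    obtain ⟨p, hp, b, hb, hne⟩ := hthick m (ball z₀ r) hball isOpen_ball ⟨z₀, mem_ball_self hr⟩
    apply hne
    have hpU : p ∈ U := hball hp
    have hratio := eq_ratio_mul_of_frozen (hfr p hpU) (hnd p hpU)
    have hsec : ∀ y ∈ {y : EuclideanSpace ℝ (Fin 3) | (p.1, y) ∈ ball z₀ r}, (p.1, y) ∈ U := fun y hy => hball hy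
    have hconst : Λv p.1 p.2 = Λv p.1 (z₀.2 + (p.2 2 - z₀.2 2) • EuclideanSpace.single 2 (1 : ℝ)) :=
      eq_of_horizontal_fderiv_eq_zero (convex_section_ball z₀ r p.1)
        (fun y hy => (analyticAt_slice (hΛan _ (hsec y hy))).differentiableAt)
        (fun y hy => (hA _ (hsec y hy)).1) (fun y hy => (hA _ (hsec y hy)).2) hp (mem_ball_of_sameHeight hp)
        (by simp)
    have hmval : m p.1 (p.2 2) = Λv p.1 p.2 := hconst.symm
    rw [hmval]
    have hΛp : Λv p.1 p.2 =
        (fderiv ℝ (u p.1) p.2 (EuclideanSpace.single 2 1) 0 * fderiv ℝ (u p.1) p.2 (EuclideanSpace.single 0 1) 2 +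
            fderiv ℝ (u p.1) p.2 (EuclideanSpace.single 2 1) 1 * fderiv ℝ (u p.1) p.2 (EuclideanSpace.single 1 1) 2) /
          (fderiv ℝ (u p.1) p.2 (EuclideanSpace.single 0 1) 2 ^ 2 + fderiv ℝ (u p.1) p.2 (EuclideanSpace.single 1 1) 2 ^ 2) := by
      rw [hΛv]
    rw [hΛp]
    fin_cases b
    · exact hratio.1
    · exact hratio.2
    · exact absurd rfl hb

/-! ### S2 from the jet-pinned local statements -/

/-- **S2 `stub_localThickTH` (`Cruxes/PoloidalWindowRigidity/Lines/local_rigidity.lean` v1) VERBATIM, from `hthick`.**  Contraposition: a germ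
with no time–height open sub-window is thick; K2-p5's local frozen law and `exists_isOpen_slopeGrad_ne_zero_local` give an open sub-window with
`∇ₕΛ ≠ 0`, to which the classical solution, analyticity, poloidality, the frozen law, non-degeneracy and the twist restrict — `hthick` says no. -/
theorem stub_localThickTH_of_localThickOpen
    (hthick : ∀ (u : ℝ → EuclideanSpace ℝ (Fin 3) → EuclideanSpace ℝ (Fin 3)) (q : ℝ → EuclideanSpace ℝ (Fin 3) → ℝ)
        (U : Set (ℝ × EuclideanSpace ℝ (Fin 3))),
        IsOpen U → U.Nonempty →
        Literature.Analysis.FluidPDE.IsClassicalNSSolutionOnRegion U 1 0 u q →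
        AnalyticOnNhd ℝ (Function.uncurry u) U →
        (∀ p ∈ U, ⟪Literature.Analysis.FluidPDE.curl (u p.1) p.2, EuclideanSpace.single 2 1⟫_ℝ = 0) →
        (∀ p ∈ U, fderiv ℝ (u p.1) p.2 (EuclideanSpace.single 2 1) 0 * fderiv ℝ (u p.1) p.2 (EuclideanSpace.single 1 1) 2 =
          fderiv ℝ (u p.1) p.2 (EuclideanSpace.single 2 1) 1 * fderiv ℝ (u p.1) p.2 (EuclideanSpace.single 0 1) 2) →
        (∀ p ∈ U, Literature.Analysis.FluidPDE.curl (u p.1) p.2 ≠ 0 ∧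
          (fderiv ℝ (u p.1) p.2 (EuclideanSpace.single 0 1) 2 ≠ 0 ∨ fderiv ℝ (u p.1) p.2 (EuclideanSpace.single 1 1) 2 ≠ 0) ∧
          (fderiv ℝ (u p.1) p.2 (EuclideanSpace.single 2 1) 0 ≠ 0 ∨ fderiv ℝ (u p.1) p.2 (EuclideanSpace.single 2 1) 1 ≠ 0)) →
        (∀ p ∈ U,
          fderiv ℝ (fun y => fderiv ℝ (u p.1) y (EuclideanSpace.single 2 1) 2) p.2 (EuclideanSpace.single 0 1) *
              fderiv ℝ (u p.1) p.2 (EuclideanSpace.single 1 1) 2 -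
            fderiv ℝ (fun y => fderiv ℝ (u p.1) y (EuclideanSpace.single 2 1) 2) p.2 (EuclideanSpace.single 1 1) *
              fderiv ℝ (u p.1) p.2 (EuclideanSpace.single 0 1) 2 ≠ 0) →
        (∀ p ∈ U,
          fderiv ℝ (fun y => (fderiv ℝ (u p.1) y (EuclideanSpace.single 2 1) 0 * fderiv ℝ (u p.1) y (EuclideanSpace.single 0 1) 2 +
              fderiv ℝ (u p.1) y (EuclideanSpace.single 2 1) 1 * fderiv ℝ (u p.1) y (EuclideanSpace.single 1 1) 2) /
            (fderiv ℝ (u p.1) y (EuclideanSpace.single 0 1) 2 ^ 2 + fderiv ℝ (u p.1) y (EuclideanSpace.single 1 1) 2 ^ 2)) p.2 (EuclideanSpace.single 0 1) ≠ 0 ∨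
          fderiv ℝ (fun y => (fderiv ℝ (u p.1) y (EuclideanSpace.single 2 1) 0 * fderiv ℝ (u p.1) y (EuclideanSpace.single 0 1) 2 +
              fderiv ℝ (u p.1) y (EuclideanSpace.single 2 1) 1 * fderiv ℝ (u p.1) y (EuclideanSpace.single 1 1) 2) /
            (fderiv ℝ (u p.1) y (EuclideanSpace.single 0 1) 2 ^ 2 + fderiv ℝ (u p.1) y (EuclideanSpace.single 1 1) 2 ^ 2)) p.2 (EuclideanSpace.single 1 1) ≠ 0) →
        False) :
    ∀ (u : ℝ → EuclideanSpace ℝ (Fin 3) → EuclideanSpace ℝ (Fin 3)) (q : ℝ → EuclideanSpace ℝ (Fin 3) → ℝ)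
      (U : Set (ℝ × EuclideanSpace ℝ (Fin 3))),
      IsOpen U → U.Nonempty →
      Literature.Analysis.FluidPDE.IsClassicalNSSolutionOnRegion U 1 0 u q →
      AnalyticOnNhd ℝ (Function.uncurry u) U →
      (∀ p ∈ U, ⟪Literature.Analysis.FluidPDE.curl (u p.1) p.2, EuclideanSpace.single 2 1⟫_ℝ = 0) →
      (∀ p ∈ U, Literature.Analysis.FluidPDE.curl (u p.1) p.2 ≠ 0 ∧
        (fderiv ℝ (u p.1) p.2 (EuclideanSpace.single 0 1) 2 ≠ 0 ∨ fderiv ℝ (u p.1) p.2 (EuclideanSpace.single 1 1) 2 ≠ 0) ∧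
        (fderiv ℝ (u p.1) p.2 (EuclideanSpace.single 2 1) 0 ≠ 0 ∨ fderiv ℝ (u p.1) p.2 (EuclideanSpace.single 2 1) 1 ≠ 0)) →
      (∀ p ∈ U,
        fderiv ℝ (fun y => fderiv ℝ (u p.1) y (EuclideanSpace.single 2 1) 2) p.2 (EuclideanSpace.single 0 1) *
            fderiv ℝ (u p.1) p.2 (EuclideanSpace.single 1 1) 2 -
          fderiv ℝ (fun y => fderiv ℝ (u p.1) y (EuclideanSpace.single 2 1) 2) p.2 (EuclideanSpace.single 1 1) *
            fderiv ℝ (u p.1) p.2 (EuclideanSpace.single 0 1) 2 ≠ 0) →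
      ∃ U₁ : Set (ℝ × EuclideanSpace ℝ (Fin 3)), U₁ ⊆ U ∧ IsOpen U₁ ∧ U₁.Nonempty ∧
        ∃ m : ℝ → ℝ → ℝ, ∀ p ∈ U₁, ∀ b : Fin 3, b ≠ 2 →
          fderiv ℝ (u p.1) p.2 (EuclideanSpace.single 2 1) b =
            m p.1 (p.2 2) * fderiv ℝ (u p.1) p.2 (EuclideanSpace.single b 1) 2 := by
  intro u q U hU hUne hreg han hpol hnd htw
  by_contra hno
  push Not at hno
  have hfr : ∀ p ∈ U,
      fderiv ℝ (u p.1) p.2 (EuclideanSpace.single 2 1) 0 * fderiv ℝ (u p.1) p.2 (EuclideanSpace.single 1 1) 2 =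
        fderiv ℝ (u p.1) p.2 (EuclideanSpace.single 2 1) 1 * fderiv ℝ (u p.1) p.2 (EuclideanSpace.single 0 1) 2 := by
    intro p hp
    have h := vertShear_wedge_horizGrad_eq_zero hU hreg hpol hp
    linarith
  obtain ⟨U', hU'U, hU'o, hU'ne, hpin⟩ := exists_isOpen_slopeGrad_ne_zero_local hU hUne han hfr (fun p hp => (hnd p hp).2.1)
    (fun m U₁ h₁ h₂ h₃ => hno U₁ h₁ h₂ h₃ m)
  exact hthick u q U' hU'o hU'ne (hreg.mono_of_isOpen hU'U hU'o) (fun z hz => han z (hU'U hz))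
    (fun p hp => hpol p (hU'U hp)) (fun p hp => hfr p (hU'U hp)) (fun p hp => hnd p (hU'U hp))
    (fun p hp => htw p (hU'U hp)) hpin

/-- **S2 `stub_localThickTH` VERBATIM, from `hleaf`** (pin `∂ₙΛ ≠ 0` with the leafwise clause). -/
theorem stub_localThickTH_of_localThickLeaf
    (hleaf : ∀ (u : ℝ → EuclideanSpace ℝ (Fin 3) → EuclideanSpace ℝ (Fin 3)) (q : ℝ → EuclideanSpace ℝ (Fin 3) → ℝ)
        (U : Set (ℝ × EuclideanSpace ℝ (Fin 3))),
        IsOpen U → U.Nonempty →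
        Literature.Analysis.FluidPDE.IsClassicalNSSolutionOnRegion U 1 0 u q →
        AnalyticOnNhd ℝ (Function.uncurry u) U →
        (∀ p ∈ U, ⟪Literature.Analysis.FluidPDE.curl (u p.1) p.2, EuclideanSpace.single 2 1⟫_ℝ = 0) →
        (∀ p ∈ U, fderiv ℝ (u p.1) p.2 (EuclideanSpace.single 2 1) 0 * fderiv ℝ (u p.1) p.2 (EuclideanSpace.single 1 1) 2 =
          fderiv ℝ (u p.1) p.2 (EuclideanSpace.single 2 1) 1 * fderiv ℝ (u p.1) p.2 (EuclideanSpace.single 0 1) 2) →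
        (∀ p ∈ U, Literature.Analysis.FluidPDE.curl (u p.1) p.2 ≠ 0 ∧
          (fderiv ℝ (u p.1) p.2 (EuclideanSpace.single 0 1) 2 ≠ 0 ∨ fderiv ℝ (u p.1) p.2 (EuclideanSpace.single 1 1) 2 ≠ 0) ∧
          (fderiv ℝ (u p.1) p.2 (EuclideanSpace.single 2 1) 0 ≠ 0 ∨ fderiv ℝ (u p.1) p.2 (EuclideanSpace.single 2 1) 1 ≠ 0)) →
        (∀ p ∈ U,
          fderiv ℝ (fun y => fderiv ℝ (u p.1) y (EuclideanSpace.single 2 1) 2) p.2 (EuclideanSpace.single 0 1) *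
              fderiv ℝ (u p.1) p.2 (EuclideanSpace.single 1 1) 2 -
            fderiv ℝ (fun y => fderiv ℝ (u p.1) y (EuclideanSpace.single 2 1) 2) p.2 (EuclideanSpace.single 1 1) *
              fderiv ℝ (u p.1) p.2 (EuclideanSpace.single 0 1) 2 ≠ 0) →
        (∀ p ∈ U,
          fderiv ℝ (fun y => (fderiv ℝ (u p.1) y (EuclideanSpace.single 2 1) 0 * fderiv ℝ (u p.1) y (EuclideanSpace.single 0 1) 2 +
              fderiv ℝ (u p.1) y (EuclideanSpace.single 2 1) 1 * fderiv ℝ (u p.1) y (EuclideanSpace.single 1 1) 2) /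
            (fderiv ℝ (u p.1) y (EuclideanSpace.single 0 1) 2 ^ 2 + fderiv ℝ (u p.1) y (EuclideanSpace.single 1 1) 2 ^ 2)) p.2 (EuclideanSpace.single 0 1) * fderiv ℝ (u p.1) p.2 (EuclideanSpace.single 1 1) 2 =
          fderiv ℝ (fun y => (fderiv ℝ (u p.1) y (EuclideanSpace.single 2 1) 0 * fderiv ℝ (u p.1) y (EuclideanSpace.single 0 1) 2 +
              fderiv ℝ (u p.1) y (EuclideanSpace.single 2 1) 1 * fderiv ℝ (u p.1) y (EuclideanSpace.single 1 1) 2) /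
            (fderiv ℝ (u p.1) y (EuclideanSpace.single 0 1) 2 ^ 2 + fderiv ℝ (u p.1) y (EuclideanSpace.single 1 1) 2 ^ 2)) p.2 (EuclideanSpace.single 1 1) * fderiv ℝ (u p.1) p.2 (EuclideanSpace.single 0 1) 2) →
        (∀ p ∈ U,
          fderiv ℝ (fun y => (fderiv ℝ (u p.1) y (EuclideanSpace.single 2 1) 0 * fderiv ℝ (u p.1) y (EuclideanSpace.single 0 1) 2 +
              fderiv ℝ (u p.1) y (EuclideanSpace.single 2 1) 1 * fderiv ℝ (u p.1) y (EuclideanSpace.single 1 1) 2) /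
            (fderiv ℝ (u p.1) y (EuclideanSpace.single 0 1) 2 ^ 2 + fderiv ℝ (u p.1) y (EuclideanSpace.single 1 1) 2 ^ 2)) p.2 (EuclideanSpace.single 0 1) * fderiv ℝ (u p.1) p.2 (EuclideanSpace.single 0 1) 2 +
          fderiv ℝ (fun y => (fderiv ℝ (u p.1) y (EuclideanSpace.single 2 1) 0 * fderiv ℝ (u p.1) y (EuclideanSpace.single 0 1) 2 +
              fderiv ℝ (u p.1) y (EuclideanSpace.single 2 1) 1 * fderiv ℝ (u p.1) y (EuclideanSpace.single 1 1) 2) /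
            (fderiv ℝ (u p.1) y (EuclideanSpace.single 0 1) 2 ^ 2 + fderiv ℝ (u p.1) y (EuclideanSpace.single 1 1) 2 ^ 2)) p.2 (EuclideanSpace.single 1 1) * fderiv ℝ (u p.1) p.2 (EuclideanSpace.single 1 1) 2 ≠ 0) →
        False) :
    ∀ (u : ℝ → EuclideanSpace ℝ (Fin 3) → EuclideanSpace ℝ (Fin 3)) (q : ℝ → EuclideanSpace ℝ (Fin 3) → ℝ)
      (U : Set (ℝ × EuclideanSpace ℝ (Fin 3))),
      IsOpen U → U.Nonempty →
      Literature.Analysis.FluidPDE.IsClassicalNSSolutionOnRegion U 1 0 u q →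
      AnalyticOnNhd ℝ (Function.uncurry u) U →
      (∀ p ∈ U, ⟪Literature.Analysis.FluidPDE.curl (u p.1) p.2, EuclideanSpace.single 2 1⟫_ℝ = 0) →
      (∀ p ∈ U, Literature.Analysis.FluidPDE.curl (u p.1) p.2 ≠ 0 ∧
        (fderiv ℝ (u p.1) p.2 (EuclideanSpace.single 0 1) 2 ≠ 0 ∨ fderiv ℝ (u p.1) p.2 (EuclideanSpace.single 1 1) 2 ≠ 0) ∧
        (fderiv ℝ (u p.1) p.2 (EuclideanSpace.single 2 1) 0 ≠ 0 ∨ fderiv ℝ (u p.1) p.2 (EuclideanSpace.single 2 1) 1 ≠ 0)) →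
      (∀ p ∈ U,
        fderiv ℝ (fun y => fderiv ℝ (u p.1) y (EuclideanSpace.single 2 1) 2) p.2 (EuclideanSpace.single 0 1) *
            fderiv ℝ (u p.1) p.2 (EuclideanSpace.single 1 1) 2 -
          fderiv ℝ (fun y => fderiv ℝ (u p.1) y (EuclideanSpace.single 2 1) 2) p.2 (EuclideanSpace.single 1 1) *
            fderiv ℝ (u p.1) p.2 (EuclideanSpace.single 0 1) 2 ≠ 0) →
      ∃ U₁ : Set (ℝ × EuclideanSpace ℝ (Fin 3)), U₁ ⊆ U ∧ IsOpen U₁ ∧ U₁.Nonempty ∧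
        ∃ m : ℝ → ℝ → ℝ, ∀ p ∈ U₁, ∀ b : Fin 3, b ≠ 2 →
          fderiv ℝ (u p.1) p.2 (EuclideanSpace.single 2 1) b =
            m p.1 (p.2 2) * fderiv ℝ (u p.1) p.2 (EuclideanSpace.single b 1) 2 :=
  stub_localThickTH_of_localThickOpen (localThickOpen_of_localThickLeaf hleaf)

end Summit.NavierStokesRegularity.NavierStokesRegularity.Theorems.PoloidalWindowDoorPoloidalWindowRigidityLocalThickTHOfLocalOpen

end
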